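import Literature.Barriers.CriticalPhenomena.LaceExpansionXSpaceLemma16
import HarnessLib

/-!
# Kernels on pairs of lattice points: the `ℓ^∞ → ℓ^∞`, `ℓ¹ → ℓ¹` and mixed norms, chains, and
# the three-factor estimate of Heydenreich–van der Hofstad (7.5.21) — PROVED (generic)

Barrier catalogue `Literature/Barriers/CriticalPhenomena/` (D-0021), infrastructure for the
weighted `N`-loop estimate `Hara2008_weightedNLoopBoundPc` of `LaceExpansionXSpaceLemma16.lean`
(Hara 2008, §3.4, Steps 2–3: "peel off (open) triangles from left and right, leaving
`|x|^β`-, `|x|^γ`-weighted parts in the middle"). The Hara–Slade diagrams (Heydenreich–van der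
Hofstad (7.4.10)) are chains `A₃(0,·) B₁ B₂ B₁ B₂ ⋯ B₁ A₃(·,x)` of kernels on PAIRS of lattice points
`(w, u) ∈ ℤ^d × ℤ^d`; §7.5 bounds such chains by three norms of a kernel `X((s,t),(u,v)) ≥ 0`:
`‖X‖_{∞→∞} = sup_{(s,t)} Σ_{(u,v)} X` (the recursion (7.5.11)–(7.5.12) for `Ψ^{(N)}`),
`‖X‖_{1→1} = sup_{(u,v)} Σ_{(s,t)} X` (the reversed recursion `Ψ̄`, (7.5.20), Exercise 7.5), and the
mixed norm `sup_{s,a₁,a₂} Σ_u X((s,s+a₁),(u,u+a₂))` of the weighted middle factor ((7.5.21):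
"`(Σ_{s,a₁} Ψ^{(i-1)}(s,s+a₁)) (Σ_{x',a₂} Ψ̄^{(N-i)}(x',x'+a₂)) (max_{s,a₁,a₂} Σ_u B̃₁(s,s+a₁,u,u+a₂))`").
This file develops that algebra once, generically over an additive commutative group `α` (later
`α = ℤ^d`) and `[0, ∞]`-valued kernels (all sums unconditional, all interchanges free):

* `pkVmul`, `pkKvec`, `pkMul` (row vector × kernel, kernel × column vector, kernel × kernel),
  `pkChainL`, `pkChainR`, `pkProd` (chains and products of lists of kernels), associativity and
  regrouping (`pkMul_assoc`, `pkKvec_pkKvec`, `pkVmul_pkVmul`, `pkChainL_cons_cons`,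
  `pkChainR_cons_cons`, `pkProd_cons_cons`, `pkChainL_append`, `pkChainR_append`,
  `pkChainR_cons_eq_pkKvec_pkProd`), the duality `tsum_pkChainL_mul`
  (`Σ_p (v Y₁⋯Y_m)(p) e(p) = Σ_p v(p) (Y₁⋯Y_m e)(p)`);
* the norms `pkNormInf`, `pkNormOne`, `pkNormMix`, translation invariance `PkTI`, `PvTI`, `PjTI`;
* PROVED estimates: `tsum_pkVmul_le` ((7.5.11): `Σ (vX) ≤ (Σ v) ‖X‖_{∞→∞}`), `tsum_pkKvec_le`,
  submultiplicativity (`pkNormInf_pkMul_le`, `pkNormOne_pkMul_le`, `…_pkProd_le`),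
  `pkNormMix_pkMul_le` (`‖XY‖_mix ≤ ‖X‖_{∞→∞} ‖Y‖_mix`), `pkNormMix_pkMul_le'`
  (`‖XY‖_mix ≤ ‖X‖_mix ‖Y‖_{1→1}`, `Y` translation invariant), `pkNormMix_pkProd_le_left/right`
  (weight on the left: "peel off `W^{(β,0)}` from the left, decompose the middle part into
  triangles" — Hara's case (b-3); weight on the right), the THREE-FACTOR estimate
  `tsum_tsum_mul_mul_le` / `tsum_pkChainL_three_factor` ((7.5.21)), the `ℓ¹` bounds for right
  chains `tsum_pkKvec_zero_le` / `tsum_pkChainR_zero_le` (Exercise 7.5), and the passage from the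
  anchored endpoint `x` to translation-invariant vectors (`pvTI_tsum`, `tsum_tsum_eq_tsum_zero`).

## References

* M. Heydenreich, R. van der Hofstad, *Progress in High-Dimensional Percolation and Random
  Graphs*, Springer 2017: §7.5.1 ((7.5.9)–(7.5.12): the `ℓ¹`/`ℓ^∞` recursion), §7.5.2
  ((7.5.18)–(7.5.23): the split `Ψ^{(i-1)} B̃₁ Ψ̄^{(N-i)}`, the reversed recursion (7.5.20),
  Exercise 7.5, the estimate (7.5.21) with `W_p(k) = max_{s,a₁,a₂} Σ_u B̃₁(s,s+a₁,u,u+a₂)`,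
  (7.5.26)–(7.5.27) (three kernels in the middle: `H_p(k)`)).
* T. Hara, Ann. Probab. 36 (2008) 530–593 (arXiv:math-ph/0504021): §3.4, Step 2 and cases
  (b-2), (b-3), (b-7).
-/

noncomputable section

namespace Literature.Barriers.CriticalPhenomena

open scoped ENNReal

variable {α : Type*}

/-! ### Row vectors, column vectors and kernels on pairs, over `[0, ∞]` -/

/-- Row vector times kernel: `(v X)(p') = Σ_p v(p) X(p, p')`. [folklore] -/
def pkVmul (v : α × α → ℝ≥0∞) (X : α × α → α × α → ℝ≥0∞) (p' : α × α) : ℝ≥0∞ :=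
  ∑' p, v p * X p p'

/-- Kernel times column vector: `(X f)(p) = Σ_{p'} X(p, p') f(p')`. [folklore] -/
def pkKvec (X : α × α → α × α → ℝ≥0∞) (f : α × α → ℝ≥0∞) (p : α × α) : ℝ≥0∞ :=
  ∑' p', X p p' * f p'

/-- Kernel product: `(X Y)(p, p'') = Σ_{p'} X(p, p') Y(p', p'')`. [folklore] -/
def pkMul (X Y : α × α → α × α → ℝ≥0∞) (p p'' : α × α) : ℝ≥0∞ :=
  ∑' p', X p p' * Y p' p''

/-- The `ℓ^∞ → ℓ^∞` norm `sup_p Σ_{p'} X(p, p')` ("`max_{u,w} Σ_{z,t,w',u'} B₁ B₂`" of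
Heydenreich–van der Hofstad (7.5.12)). [cite: HeydenreichVanDerHofstad2017, (7.5.11)–(7.5.12)] -/
def pkNormInf (X : α × α → α × α → ℝ≥0∞) : ℝ≥0∞ := ⨆ p, ∑' p', X p p'

/-- The `ℓ¹ → ℓ¹` norm `sup_{p'} Σ_p X(p, p')` (the norm propagating the reversed recursion `Ψ̄`,
Exercise 7.5). [cite: HeydenreichVanDerHofstad2017, (7.5.20) and Exercise 7.5] -/
def pkNormOne (X : α × α → α × α → ℝ≥0∞) : ℝ≥0∞ := ⨆ p', ∑' p, X p p'

/-- `Σ_{p'} X(p, p') ≤ ‖X‖_{∞→∞}`. [folklore] -/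
theorem tsum_le_pkNormInf (X : α × α → α × α → ℝ≥0∞) (p : α × α) : ∑' p', X p p' ≤ pkNormInf X :=
  le_iSup (fun p => ∑' p', X p p') p

/-- `Σ_p X(p, p') ≤ ‖X‖_{1→1}`. [folklore] -/
theorem tsum_le_pkNormOne (X : α × α → α × α → ℝ≥0∞) (p' : α × α) : ∑' p, X p p' ≤ pkNormOne X :=
  le_iSup (fun p' => ∑' p, X p p') p'

/-- `Σ_{p'} (vX)(p') f(p') = Σ_p v(p) (Xf)(p)`. [folklore] -/
theorem tsum_pkVmul_mul (v : α × α → ℝ≥0∞) (X : α × α → α × α → ℝ≥0∞) (f : α × α → ℝ≥0∞) :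
    ∑' p', pkVmul v X p' * f p' = ∑' p, v p * pkKvec X f p := by
  calc ∑' p', pkVmul v X p' * f p' = ∑' p', ∑' p, v p * X p p' * f p' :=
        tsum_congr fun p' => ENNReal.tsum_mul_right.symm
    _ = ∑' p, ∑' p', v p * X p p' * f p' := ENNReal.tsum_comm
    _ = ∑' p, v p * pkKvec X f p := by
        refine tsum_congr fun p => ?_
        rw [pkKvec, ← ENNReal.tsum_mul_left]
        exact tsum_congr fun p' => mul_assoc _ _ _

/-- **`ℓ¹` propagation to the right**: `Σ_{p'} (vX)(p') ≤ (Σ_p v(p)) · ‖X‖_{∞→∞}` (the step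
(7.5.11)). [cite: HeydenreichVanDerHofstad2017, (7.5.11)] -/
theorem tsum_pkVmul_le (v : α × α → ℝ≥0∞) (X : α × α → α × α → ℝ≥0∞) :
    ∑' p', pkVmul v X p' ≤ (∑' p, v p) * pkNormInf X := by
  calc ∑' p', pkVmul v X p' = ∑' p, ∑' p', v p * X p p' := ENNReal.tsum_comm
    _ = ∑' p, v p * ∑' p', X p p' := tsum_congr fun p => ENNReal.tsum_mul_left
    _ ≤ ∑' p, v p * pkNormInf X :=
        ENNReal.tsum_le_tsum fun p => mul_le_mul' le_rfl (tsum_le_pkNormInf X p)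
    _ = (∑' p, v p) * pkNormInf X := ENNReal.tsum_mul_right

/-- **`ℓ¹` propagation to the left**: `Σ_p (Xf)(p) ≤ ‖X‖_{1→1} · Σ_{p'} f(p')`. [folklore] -/
theorem tsum_pkKvec_le (X : α × α → α × α → ℝ≥0∞) (f : α × α → ℝ≥0∞) :
    ∑' p, pkKvec X f p ≤ pkNormOne X * ∑' p', f p' := by
  calc ∑' p, pkKvec X f p = ∑' p', ∑' p, X p p' * f p' := ENNReal.tsum_comm
    _ = ∑' p', (∑' p, X p p') * f p' := tsum_congr fun p' => ENNReal.tsum_mul_right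
    _ ≤ ∑' p', pkNormOne X * f p' :=
        ENNReal.tsum_le_tsum fun p' => mul_le_mul' (tsum_le_pkNormOne X p') le_rfl
    _ = pkNormOne X * ∑' p', f p' := ENNReal.tsum_mul_left

/-- Submultiplicativity of `‖·‖_{∞→∞}`. [folklore] -/
theorem pkNormInf_pkMul_le (X Y : α × α → α × α → ℝ≥0∞) :
    pkNormInf (pkMul X Y) ≤ pkNormInf X * pkNormInf Y := by
  refine iSup_le fun p => ?_
  calc ∑' p'', pkMul X Y p p'' = ∑' p', ∑' p'', X p p' * Y p' p'' := ENNReal.tsum_comm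
    _ = ∑' p', X p p' * ∑' p'', Y p' p'' := tsum_congr fun p' => ENNReal.tsum_mul_left
    _ ≤ ∑' p', X p p' * pkNormInf Y :=
        ENNReal.tsum_le_tsum fun p' => mul_le_mul' le_rfl (tsum_le_pkNormInf Y p')
    _ = (∑' p', X p p') * pkNormInf Y := ENNReal.tsum_mul_right
    _ ≤ pkNormInf X * pkNormInf Y := mul_le_mul' (tsum_le_pkNormInf X p) le_rfl

/-- Submultiplicativity of `‖·‖_{1→1}`. [folklore] -/
theorem pkNormOne_pkMul_le (X Y : α × α → α × α → ℝ≥0∞) :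
    pkNormOne (pkMul X Y) ≤ pkNormOne X * pkNormOne Y := by
  refine iSup_le fun p'' => ?_
  calc ∑' p, pkMul X Y p p'' = ∑' p, ∑' p', X p p' * Y p' p'' := rfl
    _ = ∑' p', ∑' p, X p p' * Y p' p'' := ENNReal.tsum_comm
    _ = ∑' p', (∑' p, X p p') * Y p' p'' := tsum_congr fun p' => ENNReal.tsum_mul_right
    _ ≤ ∑' p', pkNormOne X * Y p' p'' :=
        ENNReal.tsum_le_tsum fun p' => mul_le_mul' (tsum_le_pkNormOne X p') le_rfl
    _ = pkNormOne X * ∑' p', Y p' p'' := ENNReal.tsum_mul_left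
    _ ≤ pkNormOne X * pkNormOne Y := mul_le_mul' le_rfl (tsum_le_pkNormOne Y p'')

/-- Associativity: `X (Y f) = (X Y) f`. [folklore] -/
theorem pkKvec_pkKvec (X Y : α × α → α × α → ℝ≥0∞) (f : α × α → ℝ≥0∞) :
    pkKvec X (pkKvec Y f) = pkKvec (pkMul X Y) f := by
  funext p
  calc pkKvec X (pkKvec Y f) p = ∑' p', ∑' p'', X p p' * (Y p' p'' * f p'') := by
        refine tsum_congr fun p' => ?_
        rw [pkKvec, ← ENNReal.tsum_mul_left]
    _ = ∑' p'', ∑' p', X p p' * (Y p' p'' * f p'') := ENNReal.tsum_comm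
    _ = ∑' p'', pkMul X Y p p'' * f p'' := by
        refine tsum_congr fun p'' => ?_
        rw [pkMul, ← ENNReal.tsum_mul_right]
        exact tsum_congr fun p' => (mul_assoc _ _ _).symm

/-- Associativity: `(v X) Y = v (X Y)`. [folklore] -/
theorem pkVmul_pkVmul (v : α × α → ℝ≥0∞) (X Y : α × α → α × α → ℝ≥0∞) :
    pkVmul (pkVmul v X) Y = pkVmul v (pkMul X Y) := by
  funext p''
  calc pkVmul (pkVmul v X) Y p'' = ∑' p', ∑' p, v p * X p p' * Y p' p'' :=
        tsum_congr fun p' => ENNReal.tsum_mul_right.symm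
    _ = ∑' p, ∑' p', v p * X p p' * Y p' p'' := ENNReal.tsum_comm
    _ = ∑' p, v p * pkMul X Y p p'' := by
        refine tsum_congr fun p => ?_
        rw [pkMul, ← ENNReal.tsum_mul_left]
        exact tsum_congr fun p' => mul_assoc _ _ _

/-- Associativity of the kernel product. [folklore] -/
theorem pkMul_assoc (X Y Z : α × α → α × α → ℝ≥0∞) : pkMul (pkMul X Y) Z = pkMul X (pkMul Y Z) := by
  funext p p₃
  calc pkMul (pkMul X Y) Z p p₃ = ∑' p₂, ∑' p₁, X p p₁ * Y p₁ p₂ * Z p₂ p₃ :=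
        tsum_congr fun _ => ENNReal.tsum_mul_right.symm
    _ = ∑' p₁, ∑' p₂, X p p₁ * Y p₁ p₂ * Z p₂ p₃ := ENNReal.tsum_comm
    _ = ∑' p₁, X p p₁ * pkMul Y Z p₁ p₃ := by
        refine tsum_congr fun p₁ => ?_
        rw [pkMul, ← ENNReal.tsum_mul_left]
        exact tsum_congr fun _ => mul_assoc _ _ _

/-! ### Chains of kernels -/

/-- Left chain `v X₁ X₂ ⋯ X_m` (a row vector). [folklore] -/
def pkChainL : (α × α → ℝ≥0∞) → List (α × α → α × α → ℝ≥0∞) → α × α → ℝ≥0∞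
  | v, [] => v
  | v, X :: Xs => pkChainL (pkVmul v X) Xs

/-- Right chain `X₁ X₂ ⋯ X_m f` (a column vector). [folklore] -/
def pkChainR : List (α × α → α × α → ℝ≥0∞) → (α × α → ℝ≥0∞) → α × α → ℝ≥0∞
  | [], f => f
  | X :: Xs, f => pkKvec X (pkChainR Xs f)

/-- The product `M₀ M₁ ⋯ M_m` of a non-empty list of kernels (right-nested). [folklore] -/
def pkProd : (α × α → α × α → ℝ≥0∞) → List (α × α → α × α → ℝ≥0∞) → α × α → α × α → ℝ≥0∞
  | M, [] => M
  | M, M' :: Ms => pkMul M (pkProd M' Ms)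

/-- Unfolding of the empty left chain. [folklore] -/
@[simp] theorem pkChainL_nil (v : α × α → ℝ≥0∞) : pkChainL v [] = v := rfl

/-- Unfolding of a left chain. [folklore] -/
@[simp] theorem pkChainL_cons (v : α × α → ℝ≥0∞) (X : α × α → α × α → ℝ≥0∞)
    (Xs : List (α × α → α × α → ℝ≥0∞)) : pkChainL v (X :: Xs) = pkChainL (pkVmul v X) Xs := rfl

/-- Unfolding of the empty right chain. [folklore] -/
@[simp] theorem pkChainR_nil (f : α × α → ℝ≥0∞) : pkChainR [] f = f := rfl

/-- Unfolding of a right chain. [folklore] -/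
@[simp] theorem pkChainR_cons (X : α × α → α × α → ℝ≥0∞) (Xs : List (α × α → α × α → ℝ≥0∞))
    (f : α × α → ℝ≥0∞) : pkChainR (X :: Xs) f = pkKvec X (pkChainR Xs f) := rfl

/-- Unfolding of a one-kernel product. [folklore] -/
@[simp] theorem pkProd_nil (M : α × α → α × α → ℝ≥0∞) : pkProd M [] = M := rfl

/-- Unfolding of a product. [folklore] -/
@[simp] theorem pkProd_cons (M M' : α × α → α × α → ℝ≥0∞) (Ms : List (α × α → α × α → ℝ≥0∞)) :
    pkProd M (M' :: Ms) = pkMul M (pkProd M' Ms) := rfl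

/-- Left chains compose along concatenation. [folklore] -/
theorem pkChainL_append (v : α × α → ℝ≥0∞) (Xs Ys : List (α × α → α × α → ℝ≥0∞)) :
    pkChainL v (Xs ++ Ys) = pkChainL (pkChainL v Xs) Ys := by
  induction Xs generalizing v with
  | nil => rfl
  | cons X Xs ih => exact ih (pkVmul v X)

/-- Right chains compose along concatenation. [folklore] -/
theorem pkChainR_append (Xs Ys : List (α × α → α × α → ℝ≥0∞)) (f : α × α → ℝ≥0∞) :
    pkChainR (Xs ++ Ys) f = pkChainR Xs (pkChainR Ys f) := by
  induction Xs with
  | nil => rfl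
  | cons X Xs ih => simp [ih]

/-- A right chain is the product kernel applied to the end vector. [folklore] -/
theorem pkChainR_cons_eq_pkKvec_pkProd (M : α × α → α × α → ℝ≥0∞)
    (Ms : List (α × α → α × α → ℝ≥0∞)) (f : α × α → ℝ≥0∞) :
    pkChainR (M :: Ms) f = pkKvec (pkProd M Ms) f := by
  induction Ms generalizing M with
  | nil => rfl
  | cons M' Ms ih => rw [pkChainR_cons, ih, pkKvec_pkKvec, pkProd_cons]

/-- Two consecutive kernels of a right chain may be pre-multiplied. [folklore] -/
theorem pkChainR_cons_cons (X Y : α × α → α × α → ℝ≥0∞) (Zs : List (α × α → α × α → ℝ≥0∞))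
    (f : α × α → ℝ≥0∞) : pkChainR (X :: Y :: Zs) f = pkChainR (pkMul X Y :: Zs) f := by
  simp [pkKvec_pkKvec]

/-- Two consecutive kernels of a left chain may be pre-multiplied. [folklore] -/
theorem pkChainL_cons_cons (v : α × α → ℝ≥0∞) (X Y : α × α → α × α → ℝ≥0∞)
    (Zs : List (α × α → α × α → ℝ≥0∞)) :
    pkChainL v (X :: Y :: Zs) = pkChainL v (pkMul X Y :: Zs) := by
  simp [pkVmul_pkVmul]

/-- Two consecutive kernels of a product may be pre-multiplied. [folklore] -/
theorem pkProd_cons_cons (M X Y : α × α → α × α → ℝ≥0∞) (Zs : List (α × α → α × α → ℝ≥0∞)) :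
    pkProd M (X :: Y :: Zs) = pkProd M (pkMul X Y :: Zs) := by
  show pkMul M (pkMul X (pkProd Y Zs)) = pkMul M (pkProd (pkMul X Y) Zs)
  congr 1
  cases Zs with
  | nil => rfl
  | cons Z Zs => exact (pkMul_assoc X Y (pkProd Z Zs)).symm

/-- **Duality of the two chains**: `Σ_p (v Y₁ ⋯ Y_m)(p) e(p) = Σ_p v(p) (Y₁ ⋯ Y_m e)(p)`. [folklore] -/
theorem tsum_pkChainL_mul (v : α × α → ℝ≥0∞) (Ys : List (α × α → α × α → ℝ≥0∞))
    (e : α × α → ℝ≥0∞) : ∑' p, pkChainL v Ys p * e p = ∑' p, v p * pkChainR Ys e p := by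
  induction Ys generalizing v with
  | nil => rfl
  | cons Y Ys ih => rw [pkChainL_cons, ih, tsum_pkVmul_mul, pkChainR_cons]

/-- `Σ_p (v X₁ ⋯ X_m)(p) ≤ (Σ_p v(p)) Π_i ‖X_i‖_{∞→∞}`. [cite: HeydenreichVanDerHofstad2017, (7.5.9)–(7.5.11)] -/
theorem tsum_pkChainL_le (v : α × α → ℝ≥0∞) (Xs : List (α × α → α × α → ℝ≥0∞)) :
    ∑' p, pkChainL v Xs p ≤ (∑' p, v p) * (Xs.map pkNormInf).prod := by
  induction Xs generalizing v with
  | nil => simp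
  | cons X Xs ih =>
    calc ∑' p, pkChainL v (X :: Xs) p = ∑' p, pkChainL (pkVmul v X) Xs p := rfl
      _ ≤ (∑' p, pkVmul v X p) * (Xs.map pkNormInf).prod := ih _
      _ ≤ (∑' p, v p) * pkNormInf X * (Xs.map pkNormInf).prod :=
          mul_le_mul' (tsum_pkVmul_le v X) le_rfl
      _ = (∑' p, v p) * ((X :: Xs).map pkNormInf).prod := by
          rw [List.map_cons, List.prod_cons, mul_assoc]

/-! ### Translation invariance and the mixed norm -/

section Group

variable [AddCommGroup α]

/-- A kernel is translation invariant: `X((s+c, t+c), (u+c, v+c)) = X((s,t), (u,v))`. [folklore] -/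
def PkTI (X : α × α → α × α → ℝ≥0∞) : Prop :=
  ∀ (c : α) (p p' : α × α), X (p.1 + c, p.2 + c) (p'.1 + c, p'.2 + c) = X p p'

/-- A vector is translation invariant: `r(s+c, t+c) = r(s, t)`. [folklore] -/
def PvTI (r : α × α → ℝ≥0∞) : Prop := ∀ (c : α) (p : α × α), r (p.1 + c, p.2 + c) = r p

/-- Reindexing a sum over pairs by a translation. [folklore] -/
theorem tsum_pair_shift (F : α × α → ℝ≥0∞) (c : α) : ∑' p, F p = ∑' p : α × α, F (p.1 + c, p.2 + c) :=
  (((Equiv.addRight c).prodCongr (Equiv.addRight c)).tsum_eq F).symm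

/-- A sum over pairs `(u, v)` as a sum over `(u, a)` with `v = u + a`. [folklore] -/
theorem tsum_pair_shear (F : α × α → ℝ≥0∞) : ∑' p, F p = ∑' u, ∑' a, F (u, u + a) := by
  rw [← (Equiv.prodShear (Equiv.refl α) (fun u => Equiv.addLeft u)).tsum_eq F, ENNReal.tsum_prod']
  rfl

/-- The **mixed norm** `sup_{s,a₁,a₂} Σ_u X((s, s+a₁), (u, u+a₂))`: the left pair and the relative
displacement of the right pair fixed, the position of the right pair summed (the norm of the
weighted middle factor in (7.5.21): "`max_{s,a₁,a₂} Σ_u B̃₁(s, s+a₁, u, u+a₂)`").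
[cite: HeydenreichVanDerHofstad2017, (7.5.21)–(7.5.23)] -/
def pkNormMix (X : α × α → α × α → ℝ≥0∞) : ℝ≥0∞ :=
  ⨆ q : α × α × α, ∑' u, X (q.1, q.1 + q.2.1) (u, u + q.2.2)

/-- `Σ_u X((s,t),(u,u+a)) ≤ ‖X‖_mix`. [folklore] -/
theorem tsum_le_pkNormMix (X : α × α → α × α → ℝ≥0∞) (s t a : α) :
    ∑' u, X (s, t) (u, u + a) ≤ pkNormMix X := by
  have h : (s, t) = (s, s + (t - s)) := by rw [add_sub_cancel]
  rw [h]
  exact le_iSup (fun q : α × α × α => ∑' u, X (q.1, q.1 + q.2.1) (u, u + q.2.2)) (s, t - s, a)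

/-- Products of translation-invariant kernels are translation invariant. [folklore] -/
theorem pkTI_pkMul {X Y : α × α → α × α → ℝ≥0∞} (hX : PkTI X) (hY : PkTI Y) : PkTI (pkMul X Y) := by
  intro c p p''
  calc pkMul X Y (p.1 + c, p.2 + c) (p''.1 + c, p''.2 + c)
      = ∑' p' : α × α, X (p.1 + c, p.2 + c) (p'.1 + c, p'.2 + c) *
          Y (p'.1 + c, p'.2 + c) (p''.1 + c, p''.2 + c) := tsum_pair_shift _ c
    _ = pkMul X Y p p'' := tsum_congr fun p' => by rw [hX, hY]

/-- A translation-invariant kernel applied to a translation-invariant vector is translation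
invariant. [folklore] -/
theorem pvTI_pkKvec {X : α × α → α × α → ℝ≥0∞} {f : α × α → ℝ≥0∞} (hX : PkTI X) (hf : PvTI f) :
    PvTI (pkKvec X f) := by
  intro c p
  calc pkKvec X f (p.1 + c, p.2 + c)
      = ∑' p' : α × α, X (p.1 + c, p.2 + c) (p'.1 + c, p'.2 + c) * f (p'.1 + c, p'.2 + c) :=
        tsum_pair_shift _ c
    _ = pkKvec X f p := tsum_congr fun p' => by rw [hX, hf]

/-- Right chains of translation-invariant kernels and vectors are translation invariant.
[folklore] -/
theorem pvTI_pkChainR {Xs : List (α × α → α × α → ℝ≥0∞)} {f : α × α → ℝ≥0∞}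
    (hXs : ∀ X ∈ Xs, PkTI X) (hf : PvTI f) : PvTI (pkChainR Xs f) := by
  induction Xs with
  | nil => exact hf
  | cons X Xs ih =>
    rw [pkChainR_cons]
    exact pvTI_pkKvec (hXs X (by simp)) (ih fun Y hY => hXs Y (by simp [hY]))

/-- Products of lists of translation-invariant kernels are translation invariant. [folklore] -/
theorem pkTI_pkProd {M : α × α → α × α → ℝ≥0∞} {Ms : List (α × α → α × α → ℝ≥0∞)}
    (hM : PkTI M) (hMs : ∀ X ∈ Ms, PkTI X) : PkTI (pkProd M Ms) := by
  induction Ms generalizing M with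
  | nil => exact hM
  | cons M' Ms ih =>
    rw [pkProd_cons]
    exact pkTI_pkMul hM (ih (hMs M' (by simp)) fun Y hY => hMs Y (by simp [hY]))

/-- **`‖X Y‖_mix ≤ ‖X‖_{∞→∞} ‖Y‖_mix`.** [folklore] -/
theorem pkNormMix_pkMul_le (X Y : α × α → α × α → ℝ≥0∞) :
    pkNormMix (pkMul X Y) ≤ pkNormInf X * pkNormMix Y := by
  refine iSup_le fun q => ?_
  calc ∑' w, pkMul X Y (q.1, q.1 + q.2.1) (w, w + q.2.2)
      = ∑' p', ∑' w, X (q.1, q.1 + q.2.1) p' * Y p' (w, w + q.2.2) := ENNReal.tsum_comm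
    _ = ∑' p', X (q.1, q.1 + q.2.1) p' * ∑' w, Y p' (w, w + q.2.2) :=
        tsum_congr fun p' => ENNReal.tsum_mul_left
    _ ≤ ∑' p', X (q.1, q.1 + q.2.1) p' * pkNormMix Y :=
        ENNReal.tsum_le_tsum fun p' => mul_le_mul' le_rfl (tsum_le_pkNormMix Y p'.1 p'.2 q.2.2)
    _ = (∑' p', X (q.1, q.1 + q.2.1) p') * pkNormMix Y := ENNReal.tsum_mul_right
    _ ≤ pkNormInf X * pkNormMix Y := mul_le_mul' (tsum_le_pkNormInf X _) le_rfl

/-- Shift of a summation variable: `Σ_w G(w) = Σ_w G(w - c)`. [folklore] -/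
theorem tsum_shift_sub (G : α → ℝ≥0∞) (c : α) : ∑' w, G w = ∑' w, G (w - c) :=
  ((Equiv.subRight c).tsum_eq G).symm

/-- For a translation-invariant kernel the sum over the position of the left pair, at fixed
relative displacements, does not depend on the position of... anything:
`Σ_w Y((u, u+a), (w, w+b)) = Σ_w Y((0, a), (w, w+b))`. [folklore] -/
theorem PkTI.tsum_eq_tsum_zero {Y : α × α → α × α → ℝ≥0∞} (hY : PkTI Y) (u a b : α) :
    ∑' w, Y (u, u + a) (w, w + b) = ∑' w, Y (0, a) (w, w + b) := by
  calc ∑' w, Y (u, u + a) (w, w + b) = ∑' w, Y (0, a) (w - u, w - u + b) := by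
        refine tsum_congr fun w => ?_
        have h := hY u (0, a) (w - u, w - u + b)
        dsimp only at h
        rw [zero_add, sub_add_cancel, show w - u + b + u = w + b by abel, add_comm a u] at h
        exact h
    _ = ∑' w, Y (0, a) (w, w + b) := (tsum_shift_sub (fun w => Y (0, a) (w, w + b)) u).symm

/-- For a translation-invariant kernel, `Σ_{a,w} Y((0,a),(w,w+b)) = Σ_p Y(p,(0,b)) ≤ ‖Y‖_{1→1}`.
[folklore] -/
theorem tsum_tsum_le_pkNormOne {Y : α × α → α × α → ℝ≥0∞} (hY : PkTI Y) (b : α) :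
    ∑' a, ∑' w, Y (0, a) (w, w + b) ≤ pkNormOne Y := by
  have h : ∑' p : α × α, Y p (0, b) = ∑' a, ∑' w, Y (0, a) (w, w + b) := by
    calc ∑' p : α × α, Y p (0, b) = ∑' s, ∑' a, Y (s, s + a) (0, b) := tsum_pair_shear _
      _ = ∑' s, ∑' a, Y (0, a) (-s, -s + b) := by
          refine tsum_congr fun s => tsum_congr fun a => ?_
          have h := hY (-s) (s, s + a) (0, b)
          dsimp only at h
          rw [add_neg_cancel, show s + a + -s = a by abel, zero_add, show b + -s = -s + b by abel] at h
          exact h.symm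
      _ = ∑' a, ∑' s, Y (0, a) (-s, -s + b) := ENNReal.tsum_comm
      _ = ∑' a, ∑' w, Y (0, a) (w, w + b) :=
          tsum_congr fun a => (Equiv.neg α).tsum_eq (fun w => Y (0, a) (w, w + b))
  rw [← h]
  exact tsum_le_pkNormOne Y _

/-- **`‖X Y‖_mix ≤ ‖X‖_mix ‖Y‖_{1→1}`** for translation-invariant `Y`. [folklore] -/
theorem pkNormMix_pkMul_le' (X Y : α × α → α × α → ℝ≥0∞) (hY : PkTI Y) :
    pkNormMix (pkMul X Y) ≤ pkNormMix X * pkNormOne Y := by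
  refine iSup_le fun q => ?_
  calc ∑' w, pkMul X Y (q.1, q.1 + q.2.1) (w, w + q.2.2)
      = ∑' p', ∑' w, X (q.1, q.1 + q.2.1) p' * Y p' (w, w + q.2.2) := ENNReal.tsum_comm
    _ = ∑' p', X (q.1, q.1 + q.2.1) p' * ∑' w, Y p' (w, w + q.2.2) :=
        tsum_congr fun p' => ENNReal.tsum_mul_left
    _ = ∑' u, ∑' a, X (q.1, q.1 + q.2.1) (u, u + a) * ∑' w, Y (u, u + a) (w, w + q.2.2) :=
        tsum_pair_shear _
    _ = ∑' u, ∑' a, X (q.1, q.1 + q.2.1) (u, u + a) * ∑' w, Y (0, a) (w, w + q.2.2) := by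
        refine tsum_congr fun u => tsum_congr fun a => ?_
        rw [hY.tsum_eq_tsum_zero]
    _ = ∑' a, (∑' u, X (q.1, q.1 + q.2.1) (u, u + a)) * ∑' w, Y (0, a) (w, w + q.2.2) := by
        rw [ENNReal.tsum_comm]
        exact tsum_congr fun a => ENNReal.tsum_mul_right
    _ ≤ ∑' a, pkNormMix X * ∑' w, Y (0, a) (w, w + q.2.2) :=
        ENNReal.tsum_le_tsum fun a => mul_le_mul' (tsum_le_pkNormMix X _ _ a) le_rfl
    _ = pkNormMix X * ∑' a, ∑' w, Y (0, a) (w, w + q.2.2) := ENNReal.tsum_mul_left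
    _ ≤ pkNormMix X * pkNormOne Y := mul_le_mul' le_rfl (tsum_tsum_le_pkNormOne hY _)

omit [AddCommGroup α] in
/-- `‖M₀ M₁ ⋯ M_m‖_{1→1} ≤ Π ‖M_i‖_{1→1}`. [folklore] -/
theorem pkNormOne_pkProd_le (M : α × α → α × α → ℝ≥0∞) (Ms : List (α × α → α × α → ℝ≥0∞)) :
    pkNormOne (pkProd M Ms) ≤ pkNormOne M * (Ms.map pkNormOne).prod := by
  induction Ms generalizing M with
  | nil => simp
  | cons M' Ms ih =>
    calc pkNormOne (pkProd M (M' :: Ms)) ≤ pkNormOne M * pkNormOne (pkProd M' Ms) :=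
          pkNormOne_pkMul_le _ _
      _ ≤ pkNormOne M * (pkNormOne M' * (Ms.map pkNormOne).prod) := mul_le_mul' le_rfl (ih M')
      _ = pkNormOne M * ((M' :: Ms).map pkNormOne).prod := by rw [List.map_cons, List.prod_cons]

omit [AddCommGroup α] in
/-- `‖M₀ M₁ ⋯ M_m‖_{∞→∞} ≤ Π ‖M_i‖_{∞→∞}`. [folklore] -/
theorem pkNormInf_pkProd_le (M : α × α → α × α → ℝ≥0∞) (Ms : List (α × α → α × α → ℝ≥0∞)) :
    pkNormInf (pkProd M Ms) ≤ pkNormInf M * (Ms.map pkNormInf).prod := by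
  induction Ms generalizing M with
  | nil => simp
  | cons M' Ms ih =>
    calc pkNormInf (pkProd M (M' :: Ms)) ≤ pkNormInf M * pkNormInf (pkProd M' Ms) :=
          pkNormInf_pkMul_le _ _
      _ ≤ pkNormInf M * (pkNormInf M' * (Ms.map pkNormInf).prod) := mul_le_mul' le_rfl (ih M')
      _ = pkNormInf M * ((M' :: Ms).map pkNormInf).prod := by rw [List.map_cons, List.prod_cons]

/-- **The mixed norm of a product, weight on the LEFT**: `‖M₀ M₁ ⋯ M_m‖_mix ≤ ‖M₀‖_mix Π_{i≥1}
‖M_i‖_{1→1}` for translation-invariant `M₁, …, M_m` (Hara's case (b-3): "peel off `W^{(β,0)}` from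
the left, decompose the middle part into triangles"). [folklore] -/
theorem pkNormMix_pkProd_le_left (M : α × α → α × α → ℝ≥0∞) (Ms : List (α × α → α × α → ℝ≥0∞))
    (hMs : ∀ X ∈ Ms, PkTI X) : pkNormMix (pkProd M Ms) ≤ pkNormMix M * (Ms.map pkNormOne).prod := by
  cases Ms with
  | nil => simp
  | cons M' Ms =>
    have hM' : PkTI M' := hMs M' (by simp)
    have hMs' : ∀ X ∈ Ms, PkTI X := fun X hX => hMs X (by simp [hX])
    calc pkNormMix (pkProd M (M' :: Ms)) ≤ pkNormMix M * pkNormOne (pkProd M' Ms) :=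
          pkNormMix_pkMul_le' _ _ (pkTI_pkProd hM' hMs')
      _ ≤ pkNormMix M * (pkNormOne M' * (Ms.map pkNormOne).prod) :=
          mul_le_mul' le_rfl (pkNormOne_pkProd_le M' Ms)
      _ = pkNormMix M * ((M' :: Ms).map pkNormOne).prod := by rw [List.map_cons, List.prod_cons]

/-- **The mixed norm of a product, weight on the RIGHT**: `‖M₀ ⋯ M_{m-1} Z‖_mix ≤ (Π_{i<m} ‖M_i‖_{∞→∞})
‖Z‖_mix`. [folklore] -/
theorem pkNormMix_pkProd_le_right (M : α × α → α × α → ℝ≥0∞) (Ms : List (α × α → α × α → ℝ≥0∞))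
    (Z : α × α → α × α → ℝ≥0∞) :
    pkNormMix (pkProd M (Ms ++ [Z])) ≤ pkNormInf M * (Ms.map pkNormInf).prod * pkNormMix Z := by
  induction Ms generalizing M with
  | nil => simpa using pkNormMix_pkMul_le M Z
  | cons M' Ms ih =>
    calc pkNormMix (pkProd M (M' :: Ms ++ [Z])) = pkNormMix (pkMul M (pkProd M' (Ms ++ [Z]))) := rfl
      _ ≤ pkNormInf M * pkNormMix (pkProd M' (Ms ++ [Z])) := pkNormMix_pkMul_le _ _
      _ ≤ pkNormInf M * (pkNormInf M' * (Ms.map pkNormInf).prod * pkNormMix Z) :=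
          mul_le_mul' le_rfl (ih M')
      _ = pkNormInf M * ((M' :: Ms).map pkNormInf).prod * pkNormMix Z := by
          rw [List.map_cons, List.prod_cons]; ring

/-! ### The three-factor estimate (7.5.21) -/

/-- **Three factors**: `Σ_{p,p'} v(p) M(p,p') r(p') ≤ (Σ_p v(p)) · ‖M‖_mix · Σ_a r(0, a)` for a
translation-invariant `r` — the estimate (7.5.21): "`(Σ_{s,a₁} Ψ^{(i-1)}(s, s+a₁))
(Σ_{x',a₂} Ψ̄^{(N-i)}(x', x'+a₂)) (max_{s,a₁,a₂} Σ_u B̃₁(s, s+a₁, u, u+a₂))`".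
[cite: HeydenreichVanDerHofstad2017, (7.5.18)–(7.5.21)] -/
theorem tsum_tsum_mul_mul_le (v : α × α → ℝ≥0∞) (M : α × α → α × α → ℝ≥0∞) (r : α × α → ℝ≥0∞)
    (hr : PvTI r) :
    ∑' p, ∑' p', v p * M p p' * r p' ≤ (∑' p, v p) * pkNormMix M * ∑' a, r (0, a) := by
  have key : ∀ p : α × α, ∑' p', M p p' * r p' ≤ pkNormMix M * ∑' a, r (0, a) := by
    intro p
    calc ∑' p', M p p' * r p' = ∑' u, ∑' a, M p (u, u + a) * r (u, u + a) := tsum_pair_shear _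
      _ = ∑' u, ∑' a, M p (u, u + a) * r (0, a) := by
          refine tsum_congr fun u => tsum_congr fun a => ?_
          have h := hr u (0, a)
          dsimp only at h
          rw [zero_add, add_comm a u] at h
          rw [h]
      _ = ∑' a, (∑' u, M p (u, u + a)) * r (0, a) := by
          rw [ENNReal.tsum_comm]
          exact tsum_congr fun a => ENNReal.tsum_mul_right
      _ ≤ ∑' a, pkNormMix M * r (0, a) :=
          ENNReal.tsum_le_tsum fun a => mul_le_mul' (tsum_le_pkNormMix M p.1 p.2 a) le_rfl
      _ = pkNormMix M * ∑' a, r (0, a) := ENNReal.tsum_mul_left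
  calc ∑' p, ∑' p', v p * M p p' * r p' = ∑' p, v p * ∑' p', M p p' * r p' := by
        refine tsum_congr fun p => ?_
        rw [← ENNReal.tsum_mul_left]
        exact tsum_congr fun p' => mul_assoc _ _ _
    _ ≤ ∑' p, v p * (pkNormMix M * ∑' a, r (0, a)) :=
        ENNReal.tsum_le_tsum fun p => mul_le_mul' le_rfl (key p)
    _ = (∑' p, v p) * pkNormMix M * ∑' a, r (0, a) := by rw [ENNReal.tsum_mul_right, mul_assoc]

/-- **Three factors along a chain**: with the marked kernels `M₀, …, M_m` in the middle,
`Σ_p (v L₁⋯L_k M₀⋯M_m R₁⋯R_n)(p) e(p) ≤ (Σ_p (v L₁⋯L_k)(p)) · ‖M₀⋯M_m‖_mix · Σ_a (R₁⋯R_n e)(0, a)`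
for translation-invariant `R_j` and `e`. [cite: HeydenreichVanDerHofstad2017, (7.5.18)–(7.5.21)] -/
theorem tsum_pkChainL_three_factor (v : α × α → ℝ≥0∞) (L Ms R : List (α × α → α × α → ℝ≥0∞))
    (M₀ : α × α → α × α → ℝ≥0∞) (e : α × α → ℝ≥0∞) (hR : ∀ X ∈ R, PkTI X) (he : PvTI e) :
    ∑' p, pkChainL v (L ++ M₀ :: (Ms ++ R)) p * e p ≤
      (∑' p, pkChainL v L p) * pkNormMix (pkProd M₀ Ms) * ∑' a, pkChainR R e (0, a) := by
  rw [pkChainL_append, tsum_pkChainL_mul, show M₀ :: (Ms ++ R) = (M₀ :: Ms) ++ R from rfl,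
    pkChainR_append, pkChainR_cons_eq_pkKvec_pkProd]
  calc ∑' p, pkChainL v L p * pkKvec (pkProd M₀ Ms) (pkChainR R e) p
      = ∑' p, ∑' p', pkChainL v L p * pkProd M₀ Ms p p' * pkChainR R e p' := by
        refine tsum_congr fun p => ?_
        rw [pkKvec, ← ENNReal.tsum_mul_left]
        exact tsum_congr fun p' => (mul_assoc _ _ _).symm
    _ ≤ _ := tsum_tsum_mul_mul_le _ _ _ (pvTI_pkChainR hR he)

/-! ### `ℓ¹` bounds for right chains (the reversed recursion) -/

/-- `Σ_a (X r)(0, a) ≤ ‖X‖_{1→1} Σ_a r(0, a)` for translation-invariant `X`, `r`.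
[cite: HeydenreichVanDerHofstad2017, Exercise 7.5] -/
theorem tsum_pkKvec_zero_le {X : α × α → α × α → ℝ≥0∞} {r : α × α → ℝ≥0∞} (hX : PkTI X)
    (hr : PvTI r) : ∑' a, pkKvec X r (0, a) ≤ pkNormOne X * ∑' a, r (0, a) := by
  calc ∑' a, pkKvec X r (0, a) = ∑' a, ∑' u, ∑' b, X (0, a) (u, u + b) * r (u, u + b) := by
        refine tsum_congr fun a => ?_
        exact tsum_pair_shear _
    _ = ∑' a, ∑' u, ∑' b, X (0, a) (u, u + b) * r (0, b) := by
        refine tsum_congr fun a => tsum_congr fun u => tsum_congr fun b => ?_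
        have h := hr u (0, b)
        dsimp only at h
        rw [zero_add, add_comm b u] at h
        rw [h]
    _ = ∑' a, ∑' b, ∑' u, X (0, a) (u, u + b) * r (0, b) :=
        tsum_congr fun a => ENNReal.tsum_comm
    _ = ∑' b, ∑' a, ∑' u, X (0, a) (u, u + b) * r (0, b) := ENNReal.tsum_comm
    _ = ∑' b, (∑' a, ∑' u, X (0, a) (u, u + b)) * r (0, b) := by
        refine tsum_congr fun b => ?_
        rw [← ENNReal.tsum_mul_right]
        exact tsum_congr fun a => ENNReal.tsum_mul_right
    _ ≤ ∑' b, pkNormOne X * r (0, b) :=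
        ENNReal.tsum_le_tsum fun b => mul_le_mul' (tsum_tsum_le_pkNormOne hX b) le_rfl
    _ = pkNormOne X * ∑' b, r (0, b) := ENNReal.tsum_mul_left

/-- `Σ_a (X₁ ⋯ X_n e)(0, a) ≤ (Π ‖X_i‖_{1→1}) Σ_a e(0, a)` for translation-invariant `X_i`, `e`
("`Ψ̄^{(N)}` also obeys (7.5.9)"). [cite: HeydenreichVanDerHofstad2017, Exercise 7.5] -/
theorem tsum_pkChainR_zero_le (Xs : List (α × α → α × α → ℝ≥0∞)) (e : α × α → ℝ≥0∞)
    (hXs : ∀ X ∈ Xs, PkTI X) (he : PvTI e) :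
    ∑' a, pkChainR Xs e (0, a) ≤ (Xs.map pkNormOne).prod * ∑' a, e (0, a) := by
  induction Xs with
  | nil => simp
  | cons X Xs ih =>
    have hX : PkTI X := hXs X (by simp)
    have hXs' : ∀ Y ∈ Xs, PkTI Y := fun Y hY => hXs Y (by simp [hY])
    calc ∑' a, pkChainR (X :: Xs) e (0, a) ≤ pkNormOne X * ∑' a, pkChainR Xs e (0, a) :=
          tsum_pkKvec_zero_le hX (pvTI_pkChainR hXs' he)
      _ ≤ pkNormOne X * ((Xs.map pkNormOne).prod * ∑' a, e (0, a)) := mul_le_mul' le_rfl (ih hXs')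
      _ = ((X :: Xs).map pkNormOne).prod * ∑' a, e (0, a) := by
          rw [List.map_cons, List.prod_cons, mul_assoc]

/-! ### Summing out the endpoint `x` -/

/-- Joint translation invariance of an end vector depending on the endpoint `x`:
`E((s+c, t+c); x+c) = E((s,t); x)`. [folklore] -/
def PjTI (E : α × α → α → ℝ≥0∞) : Prop := ∀ (c : α) (p : α × α) (x : α), E (p.1 + c, p.2 + c) (x + c) = E p x

/-- Summing a jointly translation-invariant end vector over the endpoint gives a
translation-invariant vector. [folklore] -/
theorem pvTI_tsum {E : α × α → α → ℝ≥0∞} (hE : PjTI E) : PvTI (fun p => ∑' x, E p x) := by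
  intro c p
  dsimp only
  rw [((Equiv.addRight c).tsum_eq (fun x => E (p.1 + c, p.2 + c) x)).symm]
  exact tsum_congr fun x => hE c p x

/-- `Σ_a Σ_x E((0,a); x) = Σ_p E(p; 0)` for jointly translation-invariant `E` (moving the anchor
from `0` to `x`). [folklore] -/
theorem tsum_tsum_eq_tsum_zero {E : α × α → α → ℝ≥0∞} (hE : PjTI E) :
    ∑' a, ∑' x, E (0, a) x = ∑' p, E p 0 := by
  symm
  calc ∑' p, E p 0 = ∑' u, ∑' a, E (u, u + a) 0 := tsum_pair_shear _
    _ = ∑' u, ∑' a, E (0, a) (-u) := by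
        refine tsum_congr fun u => tsum_congr fun a => ?_
        have h := hE (-u) (u, u + a) 0
        dsimp only at h
        rw [add_neg_cancel, show u + a + -u = a by abel, zero_add] at h
        exact h.symm
    _ = ∑' a, ∑' u, E (0, a) (-u) := ENNReal.tsum_comm
    _ = ∑' a, ∑' x, E (0, a) x := tsum_congr fun a => (Equiv.neg α).tsum_eq (fun x => E (0, a) x)

end Group

end Literature.Barriers.CriticalPhenomena
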